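import Summits.NavierStokesRegularity.NavierStokesRegularity.Theorems.ScenarioCensusRoughnessMeter
import Literature.Analysis.FluidPDE.KNSSMildDecayHorizontal
import HarnessLib

/-!
# LINE «roughness-meter» port, part 2/2: the rows (§F), proofs of the decided rows (§G), nestings and controls (§H); census KEYS `Row_A2os` / `Row_A2ho` / `Row_A2hb`
# + `_excluded`, `Row_A2hw` (OPEN)

Re-homed for the scenario census (typer seat ns-census-typer-1 g8; cells of ns-idea-2 LINE g14-2 «roughness-meter», record-only ROW-KEY ADDENDUM 02:17:22Z, critic
idea-crit-3 g7 PASS — no price 02:21:58Z, ref PRE-CHECK asked by lead g10 RULING [9] (item 38); this port makes the decided cells TREE-decided): VERBATIM PORT of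
`pub/ideators/ns-idea-2/lines/roughness-meter/line-roughness-meter.lean` sha16 4218d76b6803a96e (597 l., lean check rc 0, 0 sorry), split for the 400-line rule
into `ScenarioCensusRoughnessMeter` (§A–§E) → `…RoughnessMeterRows` (§F–§H + census KEYS).  Lean text VERBATIM in namespace `…Theorems.ScenarioCensus.RoughnessMeter`
(the line's `…Lines.RoughnessMeter` re-homed); port edits: `local notation "E3"` → `abbrev E3` (typer lint: no notation in port files), `@[conjecture]` on the OPEN
row `Row_A2hw` (typed only), seven one-line docstrings added (gate lint); the kernel bound `kernel_bound_three` is the Literature lemma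
`exists_norm_oseenKernel_three_le` (`KNSSMildDecayHorizontal`) taken BY NAME (gate lint dedup.landed).  Statements untouched.

No census VALUE is moved here (cells become TREE-decided by name; booking is the lead's); NS regularity is NOT proved; (L′) ⟨10661⟩ is untouched; no summit
statement is proved by this file. Lemmas that restate already-landed tree declarations are taken BY NAME (gate lint `dedup.landed`): `kernel_bound_three` = `exists_norm_oseenKernel_three_le`.
-/

-- the summit and its single problem share the name `NavierStokesRegularity` (D-0017 nested layout)
set_option linter.dupNamespace false

noncomputable section

open Set Function Filter Topology Metric MeasureTheory

namespace Summit.NavierStokesRegularity.NavierStokesRegularity.Theorems.ScenarioCensus.RoughnessMeter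

open Literature.Analysis Literature.Analysis.FluidPDE
open Summit.NavierStokesRegularity.NavierStokesRegularity.Theorems.SymmetryModuliCountSymmetricLiouville
  (vanishes_of_vanishes_before)

/-! ## F. The rows (census A-block cells, (L′)-shape over `IsTypeIAncientMild C u` BY NAME) -/

/-- **Row A2os (OSCILLATION FLOOR — KNSS Remark 6.1 made quantitative; HEAD, PROVED, UNIVERSAL).**
There is a universal `δ₀ > 0` such that every Type-I ancient mild field (KNSS gauge, `ν = 1`, ANY
Type-I constant `C`) whose slices all have scale-invariant oscillation at most `δ₀`,
`√(-t) ‖u(t, x) - u(t, y)‖ ≤ δ₀` for all `t < 0`, `x`, `y`, vanishes identically.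
(`δ₀ = 0` is KNSS 2009 Remark 6.1 / tree `IsTypeIAncientMild.eq_zero_of_slice_const`.) -/
def Row_A2os : Prop :=
  ∃ δ₀ : ℝ, 0 < δ₀ ∧ ∀ (C : ℝ) (u : ℝ → E3 → E3), IsTypeIAncientMild C u →
    (∀ t < 0, ∀ x y : E3, Real.sqrt (-t) * ‖u t x - u t y‖ ≤ δ₀) →
      ∀ t < 0, ∀ x, u t x = 0

/-- **Row A2ho (HÖLDER ROUGHNESS FLOOR, exponent `0 ≤ α < 1`; PROVED, UNIVERSAL).**
For every `α ∈ [0, 1)` there is a universal `δ₀ = δ₀(α) > 0` such that every Type-I ancient mild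
field (ANY constant `C`) with `‖u(t, x) - u(t, y)‖ ≤ δ₀ (-t)^{-(1+α)/2} ‖x - y‖^α` for all `t < 0`,
`x`, `y` vanishes identically.  READING: a non-trivial singularity model is ROUGH at every scale —
its scale-invariant `C^α` seminorm stays above `δ₀(α)` at some pair of points of every slice. -/
def Row_A2ho : Prop :=
  ∀ α : ℝ, 0 ≤ α → α < 1 → ∃ δ₀ : ℝ, 0 < δ₀ ∧
    ∀ (C : ℝ) (u : ℝ → E3 → E3), IsTypeIAncientMild C u →
      (∀ t < 0, ∀ x y : E3, ‖u t x - u t y‖ ≤ δ₀ * (-t) ^ (-(1 + α) / 2) * ‖x - y‖ ^ α) →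
        ∀ t < 0, ∀ x, u t x = 0

/-- **Row A2hb (HÖLDER ROUGHNESS FLOOR on a BACKWARD END; PROVED, UNIVERSAL).**  The same with
the modulus hypothesis only at all sufficiently early times `t ≤ T` (backward shift into the class
+ the tree's forward uniqueness `vanishes_of_vanishes_before`). -/
def Row_A2hb : Prop :=
  ∀ α : ℝ, 0 ≤ α → α < 1 → ∃ δ₀ : ℝ, 0 < δ₀ ∧
    ∀ (C : ℝ) (u : ℝ → E3 → E3), IsTypeIAncientMild C u →
      (∃ T < 0, ∀ t ≤ T, ∀ x y : E3, ‖u t x - u t y‖ ≤ δ₀ * (-t) ^ (-(1 + α) / 2) * ‖x - y‖ ^ α) →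
        ∀ t < 0, ∀ x, u t x = 0

/-- **Row A2hw (OSCILLATION FLOOR on a SEQUENCE OF MEMORY WINDOWS; OPEN, typed).**  Oscillation
smallness only on windows `[2 t_k, t_k]` along some `t_k → -∞`: the engine then improves the
amplitude at the times `t_k` only, and no iteration is available.  A Type-I ancient field that is
nearly slice-constant on sparse far-past windows and rough in between would refute it; none is
known.  This is the liminf-type cell of the instrument. -/
@[conjecture] def Row_A2hw : Prop :=
  ∃ δ₀ : ℝ, 0 < δ₀ ∧ ∀ (C : ℝ) (u : ℝ → E3 → E3), IsTypeIAncientMild C u →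
    (∀ T < 0, ∃ t ≤ T, ∀ τ ∈ Icc (2 * t) t, ∀ x y : E3, Real.sqrt (-τ) * ‖u τ x - u τ y‖ ≤ δ₀) →
      ∀ t < 0, ∀ x, u t x = 0

/-! ## G. Proofs of the decided rows -/

/-- The universal threshold: `δ₀(α) = (1 - 1/√2) / (2 K_α)` gives `q = (1 + 1/√2)/2 < 1`. -/
theorem threshold_ok {α : ℝ} (hα0 : 0 ≤ α) (hα : α < 1) :
    0 < (1 - 1 / Real.sqrt 2) / (2 * roughConst α) ∧
      1 / Real.sqrt 2 + roughConst α * ((1 - 1 / Real.sqrt 2) / (2 * roughConst α)) < 1 := by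
  have hK := roughConst_pos (by linarith) hα
  have hs2 : 1 < Real.sqrt 2 := by
    rw [show (1 : ℝ) = Real.sqrt 1 by simp]
    exact Real.sqrt_lt_sqrt (by norm_num) (by norm_num)
  have h1 : 1 / Real.sqrt 2 < 1 := by
    rw [div_lt_one (by linarith)]; exact hs2
  have h1' : 0 < 1 - 1 / Real.sqrt 2 := by linarith
  refine ⟨by positivity, ?_⟩
  have e : roughConst α * ((1 - 1 / Real.sqrt 2) / (2 * roughConst α)) = (1 - 1 / Real.sqrt 2) / 2 := by
    field_simp
  rw [e]
  linarith

/-- **Row A2ho holds.** -/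
theorem row_A2ho_holds : Row_A2ho := by
  intro α hα0 hα
  obtain ⟨hδ, hq⟩ := threshold_ok hα0 hα
  exact ⟨_, hδ, fun C u h hmod => eq_zero_of_holderSmall h hα0 hα hδ.le hq hmod⟩

/-- The oscillation hypothesis is `HolderSmall δ 0`. -/
theorem holderSmall_zero_of_osc {δ : ℝ} {u : ℝ → E3 → E3}
    (hosc : ∀ t < 0, ∀ x y : E3, Real.sqrt (-t) * ‖u t x - u t y‖ ≤ δ) : HolderSmall δ 0 u := by
  intro t ht x y
  have hs : 0 < Real.sqrt (-t) := Real.sqrt_pos.2 (by linarith)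
  have e : (-t) ^ (-(1 + (0 : ℝ)) / 2) = (Real.sqrt (-t))⁻¹ := by
    rw [Real.sqrt_eq_rpow, ← Real.rpow_neg (by linarith)]
    norm_num
  rw [e, Real.rpow_zero, mul_one]
  have := hosc t ht x y
  rw [mul_comm] at this
  rwa [← div_eq_mul_inv, le_div_iff₀ hs]

/-- **Row A2os holds.** -/
theorem row_A2os_holds : Row_A2os := by
  obtain ⟨hδ, hq⟩ := threshold_ok (α := 0) le_rfl (by norm_num)
  exact ⟨_, hδ, fun C u h hosc =>
    eq_zero_of_holderSmall h le_rfl (by norm_num) hδ.le hq (holderSmall_zero_of_osc hosc)⟩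

/-- Backward shift: the modulus hypothesis on `t ≤ T` becomes `HolderSmall` for `t ↦ u(t + T)`
(the weight `(-t)^{-(1+α)/2}` is non-increasing in `-t`). -/
theorem holderSmall_shift {δ α T : ℝ} {u : ℝ → E3 → E3} (hδ : 0 ≤ δ) (hα : 0 ≤ 1 + α) (hT : T < 0)
    (hmod : ∀ t ≤ T, ∀ x y : E3, ‖u t x - u t y‖ ≤ δ * (-t) ^ (-(1 + α) / 2) * ‖x - y‖ ^ α) :
    HolderSmall δ α (fun t => u (t - (-T))) := by
  intro t ht x y
  have htT : t - (-T) ≤ T := by linarith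
  have h1 := hmod _ htT x y
  have hnt : 0 < -t := by linarith
  have hmono : (-(t - (-T))) ^ (-(1 + α) / 2) ≤ (-t) ^ (-(1 + α) / 2) :=
    Real.rpow_le_rpow_of_nonpos hnt (by linarith) (by
      have : -(1 + α) / 2 ≤ 0 := by linarith
      exact this)
  refine h1.trans ?_
  have : δ * (-(t - (-T))) ^ (-(1 + α) / 2) ≤ δ * (-t) ^ (-(1 + α) / 2) :=
    mul_le_mul_of_nonneg_left hmono hδ
  exact mul_le_mul_of_nonneg_right this (Real.rpow_nonneg (norm_nonneg _) _)

/-- **Row A2hb holds.** -/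
theorem row_A2hb_holds : Row_A2hb := by
  intro α hα0 hα
  obtain ⟨hδ, hq⟩ := threshold_ok hα0 hα
  refine ⟨_, hδ, fun C u h hyp => ?_⟩
  obtain ⟨T, hT, hmod⟩ := hyp
  have hv : IsTypeIAncientMild C (fun t => u (t - (-T))) := h.comp_sub_right (by linarith)
  have hvmod := holderSmall_shift hδ.le (by linarith) hT hmod
  have hz := eq_zero_of_holderSmall hv hα0 hα hδ.le hq hvmod
  refine vanishes_of_vanishes_before h hT (fun t ht x => ?_)
  have := hz (t - T) (by linarith) x
  simpa using this

/-! ## H. Nestings and controls -/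

/-- NESTING: the Hölder family at `α = 0` is the oscillation cell. -/
theorem row_A2os_of_row_A2ho : Row_A2ho → Row_A2os := by
  intro H
  obtain ⟨δ₀, hδ₀, H0⟩ := H 0 le_rfl (by norm_num)
  exact ⟨δ₀, hδ₀, fun C u h hosc => H0 C u h (holderSmall_zero_of_osc hosc)⟩

/-- NESTING: the all-times oscillation cell is implied by the (OPEN) window cell — windows are the
weaker hypothesis. -/
theorem row_A2os_of_row_A2hw : Row_A2hw → Row_A2os := by
  rintro ⟨δ₀, hδ₀, H⟩
  refine ⟨δ₀, hδ₀, fun C u h hosc => H C u h (fun T hT => ⟨T, le_rfl, fun τ hτ x y => ?_⟩)⟩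
  exact hosc τ (by linarith [hτ.2]) x y

/-- CONTROL (the `δ = 0` corner is the tree): `Row_A2os` recovers KNSS 2009 Remark 6.1 — a Type-I
ancient mild field with spatially constant slices vanishes (tree:
`IsTypeIAncientMild.eq_zero_of_slice_const`); constant slices have zero oscillation. -/
theorem sliceConst_case_of_row_A2os (H : Row_A2os) {C : ℝ} {u : ℝ → E3 → E3}
    (h : IsTypeIAncientMild C u) {b : ℝ → E3} (hub : ∀ t < 0, ∀ x, u t x = b t) :
    ∀ t < 0, ∀ x, u t x = 0 := by
  obtain ⟨δ₀, hδ₀, H⟩ := H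
  refine H C u h (fun t ht x y => ?_)
  rw [hub t ht x, hub t ht y, sub_self, norm_zero, mul_zero]
  exact hδ₀.le

/-- CONTROL (amplitude does not enter the threshold): for every Type-I constant `C`, the SAME
`δ₀(α)` works — recorded as the order of quantifiers `∃ δ₀, ∀ C` in the rows; here the explicit
engine statement with `C` free. -/
theorem universal_threshold {α : ℝ} (hα0 : 0 ≤ α) (hα : α < 1) :
    ∃ δ₀ : ℝ, 0 < δ₀ ∧ ∀ C : ℝ, ∀ u : ℝ → E3 → E3, IsTypeIAncientMild C u →
      HolderSmall δ₀ α u → ∀ t < 0, ∀ x, u t x = 0 := by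
  obtain ⟨hδ, hq⟩ := threshold_ok hα0 hα
  exact ⟨_, hδ, fun C u h hmod => eq_zero_of_holderSmall h hα0 hα hδ.le hq hmod⟩

end Summit.NavierStokesRegularity.NavierStokesRegularity.Theorems.ScenarioCensus.RoughnessMeter

namespace Summit.NavierStokesRegularity.NavierStokesRegularity.Theorems.ScenarioCensus

/-! ## Census KEYS (ns `…Theorems.ScenarioCensus`): instrument TWO-POINT ROUGHNESS (block A2) — TREE-decided cells A2os / A2ho / A2hb, OPEN row A2hw -/

/-- **Cell A2os** (oscillation floor: ∃ universal `δ₀ > 0`, ∀ `C`: `√(-t)‖u(t,x) − u(t,y)‖ ≤ δ₀` for all `t < 0`, `x`, `y` ⇒ `u ≡ 0`): `:= RoughnessMeter.Row_A2os`. DECIDED. -/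
def Row_A2os : Prop := RoughnessMeter.Row_A2os
/-- A2os is EXCLUDED (decided in the tree): `RoughnessMeter.row_A2os_holds`. -/
theorem row_A2os_excluded : Row_A2os := RoughnessMeter.row_A2os_holds

/-- **Cell A2ho** (`C^α` roughness floor, `0 ≤ α < 1`, universal `δ₀(α)`): `:= RoughnessMeter.Row_A2ho`. DECIDED. -/
def Row_A2ho : Prop := RoughnessMeter.Row_A2ho
/-- A2ho is EXCLUDED (decided in the tree): `RoughnessMeter.row_A2ho_holds`. -/
theorem row_A2ho_excluded : Row_A2ho := RoughnessMeter.row_A2ho_holds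

/-- **Cell A2hb** (the Hölder roughness floor on a backward end): `:= RoughnessMeter.Row_A2hb`. DECIDED. -/
def Row_A2hb : Prop := RoughnessMeter.Row_A2hb
/-- A2hb is EXCLUDED (decided in the tree): `RoughnessMeter.row_A2hb_holds`. -/
theorem row_A2hb_excluded : Row_A2hb := RoughnessMeter.row_A2hb_holds

/-- **Row A2hw** (oscillation floor on a sequence of memory windows) — typed only: `:= RoughnessMeter.Row_A2hw`. OPEN (no witness, no proof). -/
@[conjecture] def Row_A2hw : Prop := RoughnessMeter.Row_A2hw

/-- Lattice edge at key level: A2ho implies A2os (`RoughnessMeter.row_A2os_of_row_A2ho`, `α = 0`). -/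
theorem row_A2os_of_row_A2ho : Row_A2ho → Row_A2os := RoughnessMeter.row_A2os_of_row_A2ho
/-- Lattice edge at key level: the OPEN window cell A2hw implies A2os (`RoughnessMeter.row_A2os_of_row_A2hw`). -/
theorem row_A2os_of_row_A2hw : Row_A2hw → Row_A2os := RoughnessMeter.row_A2os_of_row_A2hw

end Summit.NavierStokesRegularity.NavierStokesRegularity.Theorems.ScenarioCensus

end
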